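import Summits.NavierStokesRegularity.NavierStokesRegularity.Theorems.TypeICertificateLadderStrainRateWeightedVorticity
import Summits.NavierStokesRegularity.NavierStokesRegularity.Theorems.SymmetryModuliCountStretchingCertificateComparisonKato
import Summits.NavierStokesRegularity.NavierStokesRegularity.Theorems.TypeICertificateLadderRungReynoldsOneTaoCover
import Literature.Analysis.FluidPDE.NSVorticityBKMHolds
import Literature.Analysis.FluidPDE.ParabolicComparison
import HarnessLib

/-!
# Route TypeICertificateLadder — the time-integrated DIRECTIONAL-stretching criterion
  (Constantin's `α − |∇ξ|²`, `ν = 1`; companion of C35 of cell pub-ns-dss; helper of crux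
  stmt-NavierStokesRegularity-2882)

Constantin's identity `(∂ₜ + u·∇ − Δ)|ω| = (α − |∇ξ|²)|ω|` on the vortex set (`α = ξ·Sξ`, `ξ = ω/|ω|`;
Constantin 1990 (2.9), Constantin–Fefferman 1993) says that the vorticity magnitude of a Navier–Stokes
flow is driven by the stretching rate along the vorticity NET of the direction-incoherence `|∇ξ|²_F`.
If on a final window `(t₀, T)` this net rate has a differentiable time-majorant,
`α − |∇ξ|²_F ≤ Λ'(t)` wherever `ω ≠ 0`, with `Λ` BOUNDED ABOVE on `(0, T)` (time-integrable up to
`T`), then `P = e^{−2Λ(t)}|ω|²` is a subsolution of `∂ₜP ≤ ΔP − u·∇P` (the tree's Kato slice lemma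
`stretchCert_slice` with the trivial certificate; zeros of `ω` are space–time minima of `P ≥ 0`), the
whole-space maximum principle bounds `‖ω(t)‖_∞ ≤ e^{Λ(t)−Λ(t₀)}‖ω(t₀)‖_∞`, and the Beale–Kato–Majda
criterion continues the solution past `T`. This refines the aligned criterion
(`TypeICertificateLadderAlignedStretchingIntegralCriterion.lean`) by the Constantin–Fefferman term and
complements C35 (sharp in the power scale `θ/(T − t)`).

* `weightedVorticity_le_of_directionalStretching_le_deriv` — the a-priori bound;
* `hasSobolevExtensionPast_of_directionalStretching_le_deriv` — continuation;
* `typeICertificateLadder_not_dominated_directionalStretching` — Fefferman class, contrapositive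
  (for every `Λ` differentiable and bounded above on `(0,T)`, the net rate exceeds `Λ'` somewhere on
  the vortex set at some time of every final window).

HONEST FRAMING: statements about a HYPOTHETICAL singular time; nothing here bears on the regularity
question itself. Lands `--supports stmt-NavierStokesRegularity-2882`.
-/

noncomputable section

namespace Summit.NavierStokesRegularity.NavierStokesRegularity.Theorems

set_option linter.dupNamespace false

open MeasureTheory Set Filter Topology Function
open scoped RealInnerProductSpace Laplacian ContDiff
open Literature.Analysis Literature.Analysis.FluidPDE

/-- **`e^{−2Λ(t)}|ω(t,x)|²` is bounded on `[t₀, T)` by its initial supremum when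
`α − |∇ξ|²_F ≤ Λ'(t)` on the vortex set of `(t₀, T)`** (classical Navier–Stokes, `ν = 1`, BKM class on
every `[0,T'']`; `Λ` differentiable on `(0,T)`). Kato with the trivial certificate
(`stretchCert_slice`, `k ≡ 1`, `δ = 1 − Λ'(t)`, `mt = 1`), zeros of `ω` as space–time minima, BKM-class
sup bounds, `le_of_subsolution_linear_drift`. [cite: Constantin1990, (2.9)] -/
theorem weightedVorticity_le_of_directionalStretching_le_deriv {T t₀ : ℝ}
    (ht₀ : 0 < t₀) (ht₀T : t₀ < T)
    {u : ℝ → EuclideanSpace ℝ (Fin 3) → EuclideanSpace ℝ (Fin 3)}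
    {p : ℝ → EuclideanSpace ℝ (Fin 3) → ℝ}
    (hsol : IsClassicalNSSolutionOn (Ico 0 T) 1 0 u p)
    (hreg : ∀ T'' < T, HasBoundedSobolevNormsOn (Icc 0 T'') u)
    {Λ lam : ℝ → ℝ} (hΛ : ∀ t ∈ Ioo 0 T, HasDerivAt Λ (lam t) t)
    (hstretch : ∀ t ∈ Ioo t₀ T, ∀ x, curl (u t) x ≠ 0 →
      ⟪fderiv ℝ (u t) x (vorticityDirection (curl (u t)) x), vorticityDirection (curl (u t)) x⟫
        - frobeniusNormSq (fderiv ℝ (vorticityDirection (curl (u t))) x) ≤ lam t) :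
    ∃ M : ℝ, ∀ t ∈ Ico t₀ T, ∀ x, Real.exp (-2 * Λ t) * ‖curl (u t) x‖ ^ 2 ≤ M := by
  -- the solution on the open slab and its vorticity equation (two-sided time derivative)
  have hsolo : IsClassicalNSSolutionOn (Ioo 0 T) 1 0 u p :=
    hsol.mono Ioo_subset_Ico_self isOpen_Ioo.uniqueDiffOn
  have hsm : IsSmoothSpaceTimeOn (Ioo 0 T) u := hsolo.smooth_velocity
  have hvort : IsSmoothSpaceTimeOn (Ioo 0 T) (vorticity u) := by
    have h1 := (hsm.isSmoothSpaceTimeOn_fderiv_of_isOpen isOpen_Ioo).clm curlCLM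
    have e : (fun t x => curlCLM (fderiv ℝ (u t) x)) = vorticity u := by funext s y; rfl
    rwa [e] at h1
  have hV := hsolo.isVorticitySolutionOn_zero_force isOpen_Ioo.uniqueDiffOn
    (by rw [interior_Ioo]; exact subset_closure)
  have hveq : ∀ t ∈ Ioo 0 T, ∀ x,
      deriv (fun s => curl (u s) x) t + fderiv ℝ (curl (u t)) x (u t x) =
        fderiv ℝ (u t) x (curl (u t) x) + (Δ (curl (u t))) x := by
    intro t ht x
    have h := hV.vorticity_eq t ht x
    simp only [timeDerivWithin_eq_deriv isOpen_Ioo ht, convect_apply, vorticity_apply,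
      one_smul] at h
    exact h
  -- smoothness of the slices
  have hsmooth : ∀ t ∈ Ico 0 T, ContDiff ℝ ∞ (u t) := fun t ht => hsol.contDiff_velocity ht
  -- the bound at the initial time `t₀`
  obtain ⟨B₁, hB₁0, hB₁⟩ := exists_forall_norm_iteratedFDeriv_le_bkmClass
    (fun t ht => hsmooth t ⟨ht.1, ht.2.trans_lt ht₀T⟩) (hreg t₀ ht₀T) 1
  set κ₀ : ℝ := ‖(curlCLM : (EuclideanSpace ℝ (Fin 3) →L[ℝ] EuclideanSpace ℝ (Fin 3)) →L[ℝ]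
    EuclideanSpace ℝ (Fin 3))‖ with hκ₀
  have hκ₀0 : 0 ≤ κ₀ := by rw [hκ₀]; positivity
  have hcurl_le : ∀ (f : EuclideanSpace ℝ (Fin 3) → EuclideanSpace ℝ (Fin 3)) (x),
      ‖curl f x‖ ≤ κ₀ * ‖iteratedFDeriv ℝ 1 f x‖ := fun f x => by
    rw [curl_eq_curlCLM, ← norm_iteratedFDeriv_fderiv, norm_iteratedFDeriv_zero]
    exact ContinuousLinearMap.le_opNorm _ _
  set M : ℝ := Real.exp (-2 * Λ t₀) * (κ₀ * B₁) ^ 2 with hMdef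
  refine ⟨M, fun t ht x => ?_⟩
  have hω₀ : ∀ y, ‖curl (u t₀) y‖ ≤ κ₀ * B₁ := fun y =>
    (hcurl_le _ y).trans (mul_le_mul_of_nonneg_left (hB₁ t₀ ⟨ht₀.le, le_rfl⟩ y) hκ₀0)
  have hPt₀ : ∀ y, Real.exp (-2 * Λ t₀) * ‖curl (u t₀) y‖ ^ 2 ≤ M := fun y => by
    rw [hMdef]
    exact mul_le_mul_of_nonneg_left (pow_le_pow_left₀ (norm_nonneg _) (hω₀ y) 2)
      (Real.exp_pos _).le
  rcases ht.1.eq_or_lt with rfl | ht₀t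
  · exact hPt₀ x
  -- the maximum principle on `[t₀, T₂]`, `T₂ = t`
  set T₂ : ℝ := t with hT₂
  have hT₂T : T₂ < T := ht.2
  obtain ⟨K, hK0, hK⟩ := exists_forall_norm_iteratedFDeriv_le_bkmClass
    (fun s hs => hsmooth s ⟨hs.1, hs.2.trans_lt hT₂T⟩) (hreg T₂ hT₂T) 0
  obtain ⟨B₂, hB₂0, hB₂⟩ := exists_forall_norm_iteratedFDeriv_le_bkmClass
    (fun s hs => hsmooth s ⟨hs.1, hs.2.trans_lt hT₂T⟩) (hreg T₂ hT₂T) 1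
  have huK : ∀ s ∈ Icc 0 T₂, ∀ y, ‖u s y‖ ≤ K := fun s hs y => by
    have h := hK s hs y
    rwa [norm_iteratedFDeriv_zero] at h
  have hωB : ∀ s ∈ Icc 0 T₂, ∀ y, ‖curl (u s) y‖ ≤ κ₀ * B₂ := fun s hs y =>
    (hcurl_le _ y).trans (mul_le_mul_of_nonneg_left (hB₂ s hs y) hκ₀0)
  -- the weighted density and its time derivative
  set P : ℝ → EuclideanSpace ℝ (Fin 3) → ℝ :=
    fun s y => Real.exp (-2 * Λ s) * ‖curl (u s) y‖ ^ 2 with hPdef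
  set Pₜ : ℝ → EuclideanSpace ℝ (Fin 3) → ℝ := fun s y =>
    Real.exp (-2 * Λ s) * (-2 * lam s) * ‖curl (u s) y‖ ^ 2 +
      Real.exp (-2 * Λ s) * (2 * ⟪curl (u s) y, deriv (fun σ => curl (u σ) y) s⟫) with hPₜdef
  have hIoc_sub : ∀ {s}, s ∈ Ioc t₀ T₂ → s ∈ Ioo 0 T := fun {s} hs =>
    ⟨ht₀.trans hs.1, hs.2.trans_lt hT₂T⟩
  have hIcc_sub : ∀ {s}, s ∈ Icc t₀ T₂ → s ∈ Ioo 0 T := fun {s} hs =>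
    ⟨ht₀.trans_le hs.1, hs.2.trans_lt hT₂T⟩
  have hPnn : ∀ s < T, ∀ y, 0 ≤ P s y := fun s _ y =>
    mul_nonneg (Real.exp_pos _).le (sq_nonneg _)
  have hPderiv : ∀ s ∈ Ioo 0 T, ∀ y, HasDerivAt (fun σ => P σ y) (Pₜ s y) s := by
    intro s hs' y
    have hTs : 0 < T - s := sub_pos.2 hs'.2
    have hw : HasDerivAt (fun σ => Real.exp (-2 * Λ σ)) (Real.exp (-2 * Λ s) * (-2 * lam s)) s := by
      have h := ((hΛ s hs').const_mul (-2 : ℝ)).exp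
      simpa using h
    have hωt : HasDerivAt (fun σ => curl (u σ) y) (deriv (fun σ => curl (u σ) y) s) s := by
      have h := hvort.hasDerivAt_timeLine isOpen_Ioo hs' y
      simpa only [vorticity_apply] using h
    exact hw.mul hωt.norm_sq
  -- `Λ` is continuous on `[t₀, T₂]`, hence bounded below there
  have hΛc : ContinuousOn Λ (Icc t₀ T₂) := fun s hs =>
    (hΛ s (hIcc_sub hs)).continuousAt.continuousWithinAt
  obtain ⟨L₀, hL₀⟩ : ∃ L₀ : ℝ, ∀ s ∈ Icc t₀ T₂, -2 * Λ s ≤ L₀ := by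
    obtain ⟨C, hC⟩ := (isCompact_Icc.image_of_continuousOn hΛc).isBounded.exists_norm_le
    refine ⟨2 * C, fun s hs => ?_⟩
    have h := hC (Λ s) ⟨s, hs, rfl⟩
    rw [Real.norm_eq_abs] at h
    linarith [neg_abs_le (Λ s)]
  have key := le_of_subsolution_linear_drift (T₁ := t₀) (T₂ := T₂) (M := M)
    (B := Real.exp L₀ * (κ₀ * B₂) ^ 2) (K := K) (P := P) (Pₜ := Pₜ) hK0 ?_ ?_ ?_ ?_ ?_ ?_
  · exact key t ⟨ht₀t.le, le_rfl⟩ x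
  · -- joint continuity on `[t₀, T₂] × ℝ³`
    have hw : ContinuousOn (fun z : ℝ × EuclideanSpace ℝ (Fin 3) => Real.exp (-2 * Λ z.1))
        (Icc t₀ T₂ ×ˢ univ) :=
      ((hΛc.comp continuous_fst.continuousOn fun z hz => (mem_prod.1 hz).1).const_smul
        (-2 : ℝ)).rexp.congr fun z _ => by simp [smul_eq_mul]
    have hωc : ContinuousOn (fun z : ℝ × EuclideanSpace ℝ (Fin 3) => ‖vorticity u z.1 z.2‖ ^ 2)
        (Icc t₀ T₂ ×ˢ univ) := by
      refine ((hvort.continuousOn.mono ?_).norm).pow 2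
      exact prod_mono (fun s hs => hIcc_sub hs) subset_rfl
    refine (hw.mul hωc).congr fun z _ => ?_
    simp only [hPdef, uncurry, Pi.mul_apply, vorticity_apply]
  · -- `C²` slices
    intro s hs
    have hω : ContDiff ℝ 2 (curl (u s)) := by
      rw [← vorticity_apply]
      exact (hvort.contDiff_slice (hIoc_sub hs)).of_le (by norm_cast)
    exact contDiff_const.mul (hω.norm_sq ℝ)
  · -- time derivative
    intro s hs y
    exact hPderiv s (hIoc_sub hs) y
  · -- the subsolution inequality `Pₜ ≤ ΔP + K (1 + ‖y‖) ‖∇P‖`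
    intro s hs y
    have hs' := hIoc_sub hs
    have hTs : 0 < T - s := sub_pos.2 hs'.2
    have hω2 : ContDiff ℝ 2 (curl (u s)) := by
      rw [← vorticity_apply]
      exact (hvort.contDiff_slice hs').of_le (by norm_cast)
    have hωd : DifferentiableAt ℝ (curl (u s)) y := (hω2.differentiable (by norm_num)) y
    set c : ℝ := Real.exp (-2 * Λ s) with hcdef
    have hc0 : 0 ≤ c := (Real.exp_pos _).le
    have hF2 : ContDiff ℝ 2 (fun z => ‖curl (u s) z‖ ^ 2) := hω2.norm_sq ℝ
    have hPs : P s = c • fun z => ‖curl (u s) z‖ ^ 2 := by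
      funext z; simp only [hPdef, Pi.smul_apply, smul_eq_mul, hcdef]
    have hP2 : ContDiff ℝ 2 (P s) := by rw [hPs]; exact hF2.const_smul c
    by_cases hω : curl (u s) y = 0
    · -- a zero of the vorticity: space–time minimum of `P ≥ 0`
      have hP0 : P s y = 0 := by simp [hPdef, hω]
      have hminx : IsLocalMin (P s) y :=
        Filter.Eventually.of_forall fun z => by rw [hP0]; exact hPnn s hs'.2 z
      have hmint : IsLocalMin (fun σ => P σ y) s := by
        filter_upwards [Iio_mem_nhds hs'.2] with σ hσ
        rw [hP0]
        exact hPnn σ hσ y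
      have hD : fderiv ℝ (P s) y = 0 := hminx.fderiv_eq_zero
      have hdt : Pₜ s y = 0 := by
        rw [← (hPderiv s hs' y).deriv]; exact hmint.deriv_eq_zero
      have hΔ : 0 ≤ (Δ (P s)) y := by
        have h1 : (Δ (fun z => -P s z)) y ≤ 0 := IsLocalMax.laplacian_nonpos hP2.neg hminx.neg
        have e : (fun z => -P s z) = -(P s) := rfl
        rw [e, InnerProductSpace.laplacian_neg, Pi.neg_apply, neg_nonpos] at h1
        exact h1
      rw [hdt, hD, norm_zero, mul_zero, add_zero]
      exact hΔ
    · -- Kato's inequality with the trivial certificate `k ≡ 1`, `δ = 1 − λ̄(s)`, `mt = 1`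
      have hk : ContDiff ℝ 2 (fun _ : EuclideanSpace ℝ (Fin 3) => (1 : ℝ)) := contDiff_const
      have htime : 2 * ⟪curl (u s) y, deriv (fun σ => curl (u σ) y) s⟫ =
          (1 : ℝ) ^ 2 * (2 * ⟪curl (u s) y, deriv (fun σ => curl (u σ) y) s⟫) +
            2 * (‖curl (u s) y‖ ^ 2 / (1 : ℝ) ^ 2) * 1 * 0 := by ring
      have hcert : ((1 : ℝ) * (⟪fderiv ℝ (u s) y (vorticityDirection (curl (u s)) y),
            vorticityDirection (curl (u s)) y⟫
          - frobeniusNormSq (fderiv ℝ (vorticityDirection (curl (u s))) y)) - 1 + (1 - lam s)) * 1 ≤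
          (1 : ℝ) * (0 + fderiv ℝ (fun _ : EuclideanSpace ℝ (Fin 3) => (1 : ℝ)) y (u s y)
            - (Δ (fun _ : EuclideanSpace ℝ (Fin 3) => (1 : ℝ))) y) := by
        have h1 := hstretch s ⟨hs.1, hs'.2⟩ y hω
        simp only [fderiv_const_apply, zero_apply,
          InnerProductSpace.laplacian_const, Pi.zero_apply, zero_add, sub_zero, mul_zero, mul_one]
        linarith
      have kato := stretchCert_slice (v := u s) (k := fun _ => (1 : ℝ)) hω2 hk (fun _ => one_ne_zero)
        hω one_pos (kt := 0) (δ := 1 - lam s) one_pos htime (hveq s hs' y) hcert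
      -- translate `‖ω‖²/1²` to `‖ω‖²`
      have eF : (fun z => ‖curl (u s) z‖ ^ 2 / (fun _ : EuclideanSpace ℝ (Fin 3) => (1 : ℝ)) z ^ 2) =
          fun z => ‖curl (u s) z‖ ^ 2 := by
        funext z; simp
      rw [eF] at kato
      simp only [fderiv_const_apply, zero_apply, mul_zero,
        Finset.sum_const_zero, add_zero, one_pow, div_one, inv_one] at kato
      -- kato : Ft + ∇F·u − ΔF ≤ 2(1 − (1−λ̄))/1 · F
      have hLap : (Δ (P s)) y = c * (Δ (fun z => ‖curl (u s) z‖ ^ 2)) y := by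
        rw [hPs, InnerProductSpace.laplacian_smul c (hF2.contDiffAt), smul_eq_mul]
      have hgrad : ∀ w, fderiv ℝ (P s) y w = c * fderiv ℝ (fun z => ‖curl (u s) z‖ ^ 2) y w := by
        intro w
        rw [hPs, fderiv_const_smul ((hF2.differentiable (by norm_num)) y),
          FunLike.coe_smul, Pi.smul_apply, smul_eq_mul]
      -- the drift bound
      have hdrift : -(fderiv ℝ (P s) y (u s y)) ≤ K * (1 + ‖y‖) * ‖fderiv ℝ (P s) y‖ := by
        have h1 : -(fderiv ℝ (P s) y (u s y)) ≤ ‖fderiv ℝ (P s) y‖ * ‖u s y‖ :=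
          (neg_le_abs _).trans ((Real.norm_eq_abs _).symm.le.trans (ContinuousLinearMap.le_opNorm _ _))
        have h2 : ‖fderiv ℝ (P s) y‖ * ‖u s y‖ ≤ ‖fderiv ℝ (P s) y‖ * K :=
          mul_le_mul_of_nonneg_left (huK s ⟨hs'.1.le, hs.2⟩ y) (norm_nonneg _)
        have h3 : ‖fderiv ℝ (P s) y‖ * K ≤ K * (1 + ‖y‖) * ‖fderiv ℝ (P s) y‖ := by
          have : 0 ≤ K * ‖y‖ * ‖fderiv ℝ (P s) y‖ := by positivity
          nlinarith
        linarith
      show Pₜ s y ≤ (Δ (P s)) y + K * (1 + ‖y‖) * ‖fderiv ℝ (P s) y‖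
      have e1 : Pₜ s y = c * (-2 * lam s) * ‖curl (u s) y‖ ^ 2 +
          c * (2 * ⟪curl (u s) y, deriv (fun σ => curl (u σ) y) s⟫) := rfl
      rw [e1, hLap]
      have e2 := hgrad (u s y)
      have hθs : (2 : ℝ) * (1 - (1 - lam s)) = 2 * lam s := by ring
      rw [hθs] at kato
      -- multiply Kato by `c ≥ 0`
      have hck := mul_le_mul_of_nonneg_left kato hc0
      nlinarith [hck, hdrift, e2, hc0, sq_nonneg ‖curl (u s) y‖]
  · -- bounded above on `[t₀, T₂] × ℝ³`
    intro s hs y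
    have hs' := hIcc_sub hs
    have hw : Real.exp (-2 * Λ s) ≤ Real.exp L₀ := Real.exp_le_exp.2 (hL₀ s hs)
    have hωb : ‖curl (u s) y‖ ^ 2 ≤ (κ₀ * B₂) ^ 2 :=
      pow_le_pow_left₀ (norm_nonneg _) (hωB s ⟨hs'.1.le, hs.2⟩ y) 2
    exact mul_le_mul hw hωb (sq_nonneg _) (Real.exp_pos _).le
  · -- the initial slice
    exact hPt₀


/-- **Time-integrable net directional stretching continues the solution (`ν = 1`).** Let `(u, p)`
be a classical Navier–Stokes solution (`ν = 1`) on `ℝ³ × [0,T)`, `T > 0`, in the BKM class on every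
`[0,T'']`, `T'' < T`; let `Λ` be differentiable on `(0,T)`, bounded above there, with
`⟪∇u ξ, ξ⟫ − |∇ξ|²_F ≤ Λ'(t)` at every point of `(t₀, T) × ℝ³` where `ω ≠ 0`. Then the solution
continues in the class past `T` (`‖ω‖` stays bounded by
`weightedVorticity_le_of_directionalStretching_le_deriv`; `beale_kato_majda_holds`). [this file] -/
theorem hasSobolevExtensionPast_of_directionalStretching_le_deriv {T t₀ : ℝ} (hT : 0 < T)
    (ht₀T : t₀ < T)
    {u : ℝ → EuclideanSpace ℝ (Fin 3) → EuclideanSpace ℝ (Fin 3)}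
    {p : ℝ → EuclideanSpace ℝ (Fin 3) → ℝ}
    (hsol : IsClassicalNSSolutionOn (Ico 0 T) 1 0 u p)
    (hreg : ∀ T'' < T, HasBoundedSobolevNormsOn (Icc 0 T'') u)
    {Λ lam : ℝ → ℝ} (hΛ : ∀ t ∈ Ioo 0 T, HasDerivAt Λ (lam t) t) {L : ℝ}
    (hL : ∀ t ∈ Ioo 0 T, Λ t ≤ L)
    (hstretch : ∀ t ∈ Ioo t₀ T, ∀ x, curl (u t) x ≠ 0 →
      ⟪fderiv ℝ (u t) x (vorticityDirection (curl (u t)) x), vorticityDirection (curl (u t)) x⟫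
        - frobeniusNormSq (fderiv ℝ (vorticityDirection (curl (u t))) x) ≤ lam t) :
    HasSobolevExtensionPast 1 u T := by
  set t₁ : ℝ := max t₀ (T / 2) with ht₁
  have ht₁0 : 0 < t₁ := lt_of_lt_of_le (by linarith) (le_max_right _ _)
  have ht₁T : t₁ < T := max_lt ht₀T (by linarith)
  obtain ⟨M, hM⟩ := weightedVorticity_le_of_directionalStretching_le_deriv ht₁0 ht₁T hsol hreg hΛ
    fun t ht x hx => hstretch t ⟨lt_of_le_of_lt (le_max_left _ _) ht.1, ht.2⟩ x hx
  -- the bound on `[0, t₁]`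
  have hsmooth : ∀ t ∈ Ico 0 T, ContDiff ℝ ∞ (u t) := fun t ht => hsol.contDiff_velocity ht
  obtain ⟨B₁, hB₁0, hB₁⟩ := exists_forall_norm_iteratedFDeriv_le_bkmClass
    (fun t ht => hsmooth t ⟨ht.1, ht.2.trans_lt ht₁T⟩) (hreg t₁ ht₁T) 1
  set κ₀ : ℝ := ‖(curlCLM : (EuclideanSpace ℝ (Fin 3) →L[ℝ] EuclideanSpace ℝ (Fin 3)) →L[ℝ]
    EuclideanSpace ℝ (Fin 3))‖ with hκ₀
  have hκ₀0 : 0 ≤ κ₀ := by rw [hκ₀]; positivity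
  have hcurl_le : ∀ (f : EuclideanSpace ℝ (Fin 3) → EuclideanSpace ℝ (Fin 3)) (x),
      ‖curl f x‖ ≤ κ₀ * ‖iteratedFDeriv ℝ 1 f x‖ := fun f x => by
    rw [curl_eq_curlCLM, ← norm_iteratedFDeriv_fderiv, norm_iteratedFDeriv_zero]
    exact ContinuousLinearMap.le_opNorm _ _
  set Kc : ℝ := max (κ₀ * B₁) (Real.sqrt (Real.exp (2 * L) * M)) with hKc
  have hbound : ∀ t ∈ Ioo 0 T, ∀ x, ‖curl (u t) x‖ ≤ Kc := by
    intro t ht x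
    rcases lt_or_ge t t₁ with hlt | hge
    · exact ((hcurl_le _ x).trans (mul_le_mul_of_nonneg_left (hB₁ t ⟨ht.1.le, hlt.le⟩ x) hκ₀0)).trans
        (le_max_left _ _)
    · have h1 := hM t ⟨hge, ht.2⟩ x
      have hexp : ‖curl (u t) x‖ ^ 2 ≤ Real.exp (2 * L) * M := by
        have e : ‖curl (u t) x‖ ^ 2 =
            Real.exp (2 * Λ t) * (Real.exp (-2 * Λ t) * ‖curl (u t) x‖ ^ 2) := by
          rw [← mul_assoc, ← Real.exp_add, show 2 * Λ t + -2 * Λ t = 0 by ring, Real.exp_zero,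
            one_mul]
        rw [e]
        exact mul_le_mul (Real.exp_le_exp.2 (by linarith [hL t ht])) h1
          (mul_nonneg (Real.exp_pos _).le (sq_nonneg _)) (Real.exp_pos _).le
      have h2 : ‖curl (u t) x‖ ≤ Real.sqrt (Real.exp (2 * L) * M) := by
        rw [← Real.sqrt_sq (norm_nonneg (curl (u t) x))]
        exact Real.sqrt_le_sqrt hexp
      exact h2.trans (le_max_right _ _)
  have hfin : (∫⁻ t in Ioo 0 T, ⨆ x, ‖curl (u t) x‖ₑ) < ⊤ := by
    have hconst : (∫⁻ _ in Ioo 0 T, ENNReal.ofReal Kc) < ⊤ := by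
      rw [setLIntegral_const]
      exact ENNReal.mul_lt_top ENNReal.ofReal_lt_top (by simp [Real.volume_Ioo])
    refine lt_of_le_of_lt (setLIntegral_mono' measurableSet_Ioo fun t ht => ?_) hconst
    refine iSup_le fun x => ?_
    rw [← ofReal_norm]
    exact ENNReal.ofReal_le_ofReal (hbound t ht x)
  exact (beale_kato_majda_holds zero_le_one hT hsol hreg).2 hfin

/-- **Fefferman / Leray–Hopf class, contrapositive: at a singular time the net directional
stretching is not dominated by the derivative of any function bounded above.** A classical solution
of unforced Navier–Stokes (`ν = 1`) on `ℝ³ × [0,T)` (`T > 0`), Leray–Hopf from its rapidly decaying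
datum, with no smooth extension past `T`: for every `t₀ < T` and every `Λ` differentiable on `(0,T)`
with `Λ ≤ L` there, there are `t ∈ (t₀, T)` and `x` with `ω(t,x) ≠ 0` and
`Λ'(t) < ⟪∇u(t,x) ξ, ξ⟫ − |∇ξ(t,x)|²_F`. [this file] -/
theorem typeICertificateLadder_not_dominated_directionalStretching {T t₀ : ℝ} (hT : 0 < T)
    (ht₀T : t₀ < T)
    {u : ℝ → EuclideanSpace ℝ (Fin 3) → EuclideanSpace ℝ (Fin 3)}
    {p : ℝ → EuclideanSpace ℝ (Fin 3) → ℝ}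
    (hsol : IsClassicalNSSolutionOn (Ico 0 T) 1 0 u p) (hLH : IsLerayHopfOn T 1 0 (u 0) u)
    (hdec : HasRapidSpatialDecay (u 0)) (hsing : ¬ HasSmoothExtensionPast 1 0 u T)
    {Λ lam : ℝ → ℝ} (hΛ : ∀ t ∈ Ioo 0 T, HasDerivAt Λ (lam t) t) {L : ℝ}
    (hL : ∀ t ∈ Ioo 0 T, Λ t ≤ L) :
    ∃ t ∈ Ioo t₀ T, ∃ x, curl (u t) x ≠ 0 ∧
      lam t < ⟪fderiv ℝ (u t) x (vorticityDirection (curl (u t)) x),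
          vorticityDirection (curl (u t)) x⟫
        - frobeniusNormSq (fderiv ℝ (vorticityDirection (curl (u t))) x) := by
  have hreg : ∀ T'' < T, HasBoundedSobolevNormsOn (Icc 0 T'') u := by
    intro T'' hT''
    set T' : ℝ := max T'' (T / 2) with hT'
    have hT'm : T' ∈ Ioo 0 T :=
      ⟨lt_of_lt_of_le (by linarith) (le_max_right _ _), max_lt hT'' (by linarith)⟩
    obtain ⟨q, -, hB, -, -⟩ := RungReynoldsOne.stub_taoCover one_pos hT hsol hLH hdec hT'm
    exact hB.mono (Icc_subset_Icc_right (le_max_left _ _))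
  by_contra h
  push Not at h
  exact hsing (hasSobolevExtensionPast_of_directionalStretching_le_deriv hT ht₀T hsol hreg hΛ hL
    (fun t ht x hx => h t ht x hx)).hasSmoothExtensionPast

end Summit.NavierStokesRegularity.NavierStokesRegularity.Theorems

end
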